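import Mathlib
import Summits.PneNP.PneNP.Theorems.OverlapGapAlgebraSolvableImpliesStableSectionMeanSquareFromMeanFilter
import Summits.PneNP.PneNP.Theorems.OverlapGapAlgebraSolvableImpliesStableSectionMonotoneRepairObjects
import Summits.PneNP.PneNP.Theorems.OverlapGapAlgebraSolvableImpliesStableSectionTwoWayRepairMean
import Summits.PneNP.PneNP.Theorems.OverlapGapAlgebraSolvableImpliesStableSectionTwoWayRepairLocal
import Summits.PneNP.PneNP.Theorems.OverlapGapAlgebraSolvableImpliesStableSectionTwoWayRepairObjects
import Summits.PneNP.PneNP.Theorems.OverlapGapAlgebraSolvableImpliesStableSectionPurePeelingAssembly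

/-!
# PneNP / OverlapGapAlgebra — crux `SolvableImpliesStableSection` (stmt-PneNP-2463):
# the TWO-WAY REPAIR block (14/·) — assembly: f-free stable sections for every ν up to `2^k/(4k)`

Support for crux `stmt-PneNP-2463` (`Summit.PneNP.PneNP.Theses.OverlapGapAlgebra.SolvableImpliesStableSection`).
THE RESULT OF THE BLOCK.  For every `k ≥ 3`, every density `α > 0` with `4k·α ≤ 2^k`, and ALL
`η, ν, c > 0`, the conclusion of the crux holds outright for all large `n`: some map `g` is `νm`-valid
at every splice point of the Bresler–Huang path and `ηn`-stable between consecutive splice points on at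
least `e^{-cn}·#paths` of the path tuples — with NO condition on `ν` (the monotone-repair block,
`sissR_conclusion_of_density_le`, needed `ν > α^k/2^{k²}`, the dead floor of one-way repair).  The map
is `Λ = Λ(ν)` rounds of TWO-WAY REPAIR WITH ONE-ROUND MEMORY (`…TwoWayRepairDynamics`: every violated
clause flips its least slot in the priority "negative & quiet < positive & quiet < flipped last round");
it is a radius-`Λ` local rule (`sissW_local`), so the mean-square engine from a mean bound
(`sissMV_concl_of_localMean`) applies, and its mean violation is `≤ (m·2^{-k}(2/3)^Λ + O_{k,Λ}(m/n))`
per instance (`sissW_sum_card_violated_le`: witness trees without dead roots).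

* `sissW_conclusion_of_density_le` — the conclusion of the crux for `k ≥ 3`, `4kα ≤ 2^k`, all
  `η, ν, c > 0`;
* `sissW_solvableImpliesStableSection_of_density_le` — the implication of the crux there (hypothesis
  unused);
* `sissW_solvableImpliesStableSection_off_core` — the crux off the CORE
  `{2^k/(4k) < α < 2^k log 2} ∩ {η < 1} ∩ {ν ≤ 2^{-k} min(1, e^{kα2^{-k}} - 1)}`: the sliver of the
  monotone-repair block is gone, the f-free region is clean.
No new definitions; axioms `propext`, `Classical.choice`, `Quot.sound`.
-/

set_option linter.dupNamespace false -- `Summit.PneNP.PneNP.…`: summit = sub-problem (D-0017)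

namespace Summit.PneNP.PneNP.Theorems

open Finset Filter Asymptotics
open scoped Classical

section Assembly

/-- **The two-way repair block: the conclusion of `SolvableImpliesStableSection` holds for
`α ≤ 2^k/(4k)`, for every `ν`.** For every `k ≥ 3`, `α > 0` with `4k·α ≤ 2^k`, and all `η, ν, c > 0`:
for all large `n` (`m = ⌊α n⌋₊`) some map `g` (bounded-round two-way repair with one-round memory) is
`νm`-valid at every splice point of the Bresler–Huang path and `ηn`-stable between consecutive splice
points on at least `e^{-cn}·#paths` of the path tuples `Ψ : Fin (k+1) → instances`. -/
theorem sissW_conclusion_of_density_le (k : ℕ) (hk : 3 ≤ k) (α η ν : ℝ) (hα : 0 < α)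
    (hαk : α * (4 * k) ≤ (2 : ℝ) ^ k) (hη : 0 < η) (hν : 0 < ν)
    (c : ℝ) (hc : 0 < c) :
    ∀ᶠ n : ℕ in atTop, ∀ m : ℕ, m = ⌊α * n⌋₊ →
      ∃ g : (Fin m → Fin k → Fin n × Bool) → (Fin n → Bool),
        Real.exp (-(c * n)) * Fintype.card (Fin (k + 1) → Fin m → Fin k → Fin n × Bool) ≤
        ((Finset.univ.filter fun Ψ : Fin (k + 1) → Fin m → Fin k → Fin n × Bool =>
          let P : Fin k → ℕ → Fin m → Fin k → Fin n × Bool :=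
            fun r q a b => if (a : ℕ) * k + b < q then Ψ r.succ a b else Ψ r.castSucc a b
          (∀ r : Fin k, ∀ q ≤ m * k, ((Finset.univ.filter fun i : Fin m =>
            ∀ j, g (P r q) (P r q i j).1 ≠ (P r q i j).2).card : ℝ) ≤ ν * m) ∧
          ∀ r : Fin k, ∀ q < m * k,
            (hammingDist (g (P r q)) (g (P r (q + 1))) : ℝ) ≤ η * n).card : ℝ) := by
  have hk0R : (0 : ℝ) < k := by exact_mod_cast (show 0 < k by omega)
  -- the target mean level `μ = ν/2` and the number of rounds `Λ`
  set μ : ℝ := ν / 2 with hμ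
  have hμν : μ < ν := by rw [hμ]; linarith
  obtain ⟨Λ, hΛ⟩ : ∃ Λ : ℕ, (2 / 3 : ℝ) ^ Λ < ν / 4 :=
    exists_pow_lt_of_lt_one (by positivity) (by norm_num)
  -- the bad-walk constant
  set B : ℝ := ∑ Lw ∈ Finset.range (2 * Λ + 1),
    α ^ Lw * ((k : ℝ) ^ (Lw + 1) * (k : ℝ) ^ (Lw + 1) * (((Lw : ℝ) + 1) * k)) with hB
  have hB0 : 0 ≤ B := Finset.sum_nonneg fun Lw _ => by positivity
  refine sissMV_concl_of_localMean k Λ (by omega) α η ν μ hα hη hμν ?_ c hc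
  have hlarge : ∀ᶠ n : ℕ in atTop, 4 * B / ν ≤ (n : ℝ) :=
    tendsto_natCast_atTop_atTop.eventually_ge_atTop _
  filter_upwards [eventually_ge_atTop 1, hlarge] with n hn1 hnB m hm
  have hnR : (1 : ℝ) ≤ n := by exact_mod_cast hn1
  have hnpos : (0 : ℝ) < n := by linarith
  have hm0 : (0 : ℝ) ≤ m := Nat.cast_nonneg _
  have hm_le : (m : ℝ) ≤ α * n := by rw [hm]; exact Nat.floor_le (by positivity)
  have hmn : (m : ℝ) / n ≤ α := by rw [div_le_iff₀ hnpos]; exact hm_le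
  have hα' : (m : ℝ) * (4 * k) ≤ (n : ℝ) * 2 ^ k :=
    calc (m : ℝ) * (4 * k) ≤ α * n * (4 * k) := mul_le_mul_of_nonneg_right hm_le (by positivity)
      _ = n * (α * (4 * k)) := by ring
      _ ≤ n * 2 ^ k := mul_le_mul_of_nonneg_left hαk hnpos.le
  have hBn : B / n ≤ ν / 4 := by
    rw [div_le_iff₀ hnpos]
    rw [div_le_iff₀ hν] at hnB
    linarith
  -- the objects of the block
  obtain ⟨val, hval0, hvalW⟩ := sissW_exists_val (m := m) (k := k) (n := n)
  obtain ⟨asm, hasm⟩ := sissR_exists_asm (m := m) (k := k)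
  obtain ⟨TS, hTS0, hTSs⟩ := sissR_exists_TS asm (2 * Λ + 1)
  refine ⟨fun Φ v => val Λ Φ v, fun Φ Φ' v H => sissW_local val hval0 hvalW Λ Φ Φ' v H, ?_⟩
  -- the mean violation
  have hmean := sissW_sum_card_violated_le asm hasm TS Λ hTS0 hTSs val hval0 hvalW hk hn1 hα'
  refine hmean.trans ?_
  set N : ℝ := (Fintype.card (Fin m → Fin k → Fin n × Bool) : ℝ) with hN
  have hN0 : 0 ≤ N := Nat.cast_nonneg _
  -- term 1: the geometric tail
  have hT1 : (m : ℝ) * (1 / 2 : ℝ) ^ k * (2 / 3 : ℝ) ^ Λ ≤ (m : ℝ) * (ν / 4) := by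
    have h1 : (1 / 2 : ℝ) ^ k ≤ 1 := pow_le_one₀ (by norm_num) (by norm_num)
    calc (m : ℝ) * (1 / 2 : ℝ) ^ k * (2 / 3 : ℝ) ^ Λ ≤ (m : ℝ) * 1 * (ν / 4) := by
          apply mul_le_mul (mul_le_mul_of_nonneg_left h1 hm0) hΛ.le (by positivity) (by positivity)
      _ = (m : ℝ) * (ν / 4) := by ring
  -- term 2: the bad walks
  have hT3 : ∑ Lw ∈ Finset.range (2 * Λ + 1),
      ((m : ℝ) ^ (Lw + 1) * (k : ℝ) ^ (Lw + 1) * (k : ℝ) ^ (Lw + 1) * (((Lw : ℝ) + 1) * k) * N) /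
        (n : ℝ) ^ (Lw + 1) ≤ (m : ℝ) * N * (B / n) := by
    have hterm : ∀ Lw : ℕ, ((m : ℝ) ^ (Lw + 1) * (k : ℝ) ^ (Lw + 1) * (k : ℝ) ^ (Lw + 1) *
        (((Lw : ℝ) + 1) * k) * N) / (n : ℝ) ^ (Lw + 1)
          ≤ (m : ℝ) * N * (α ^ Lw * ((k : ℝ) ^ (Lw + 1) * (k : ℝ) ^ (Lw + 1) * (((Lw : ℝ) + 1) * k)) / n) := by
      intro Lw
      have hpow : (m : ℝ) ^ (Lw + 1) / (n : ℝ) ^ (Lw + 1) ≤ α ^ Lw * ((m : ℝ) / n) := by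
        rw [← div_pow, pow_succ]
        exact mul_le_mul_of_nonneg_right (pow_le_pow_left₀ (by positivity) hmn Lw) (by positivity)
      have hK : 0 ≤ (k : ℝ) ^ (Lw + 1) * (k : ℝ) ^ (Lw + 1) * (((Lw : ℝ) + 1) * k) * N := by positivity
      calc ((m : ℝ) ^ (Lw + 1) * (k : ℝ) ^ (Lw + 1) * (k : ℝ) ^ (Lw + 1) * (((Lw : ℝ) + 1) * k) * N) /
            (n : ℝ) ^ (Lw + 1)
          = ((m : ℝ) ^ (Lw + 1) / (n : ℝ) ^ (Lw + 1)) *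
              ((k : ℝ) ^ (Lw + 1) * (k : ℝ) ^ (Lw + 1) * (((Lw : ℝ) + 1) * k) * N) := by ring
        _ ≤ (α ^ Lw * ((m : ℝ) / n)) *
              ((k : ℝ) ^ (Lw + 1) * (k : ℝ) ^ (Lw + 1) * (((Lw : ℝ) + 1) * k) * N) :=
            mul_le_mul_of_nonneg_right hpow hK
        _ = (m : ℝ) * N * (α ^ Lw * ((k : ℝ) ^ (Lw + 1) * (k : ℝ) ^ (Lw + 1) * (((Lw : ℝ) + 1) * k)) / n) := by
            ring
    refine (Finset.sum_le_sum fun Lw _ => hterm Lw).trans (le_of_eq ?_)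
    rw [← Finset.mul_sum, ← Finset.sum_div]
  -- total
  calc N * ((m : ℝ) * (1 / 2 : ℝ) ^ k * (2 / 3 : ℝ) ^ Λ) +
        ∑ Lw ∈ Finset.range (2 * Λ + 1),
          ((m : ℝ) ^ (Lw + 1) * (k : ℝ) ^ (Lw + 1) * (k : ℝ) ^ (Lw + 1) * (((Lw : ℝ) + 1) * k) * N) /
            (n : ℝ) ^ (Lw + 1)
      ≤ N * ((m : ℝ) * (ν / 4)) + (m : ℝ) * N * (B / n) :=
        add_le_add (mul_le_mul_of_nonneg_left hT1 hN0) hT3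
    _ ≤ N * ((m : ℝ) * (ν / 4)) + (m : ℝ) * N * (ν / 4) := by
        have : 0 ≤ (m : ℝ) * N := by positivity
        nlinarith
    _ = μ * m * N := by rw [hμ]; ring

/-- **`SolvableImpliesStableSection` up to density `2^k/(4k)`, every `ν`.** For every `k ≥ 3`,
`α > 0` with `4k·α ≤ 2^k`, and all `η, ν > 0`, the implication of the crux at `(k, α, η, ν)` holds —
its conclusion is true outright (`sissW_conclusion_of_density_le`), the solver hypothesis is not used.
Supersedes `sissR_solvableImpliesStableSection_of_density_le` (no floor condition on `ν`). -/
theorem sissW_solvableImpliesStableSection_of_density_le (k : ℕ) (hk : 3 ≤ k) (α η ν : ℝ)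
    (hα : 0 < α) (hαk : α * (4 * k) ≤ (2 : ℝ) ^ k) (hη : 0 < η) (hν : 0 < ν)
    (_hsolv : ∃ f : List Bool → List Bool, Literature.Computability.Complexity.IsPolyTime f ∧
      ∃ ε : ℝ, 0 < ε ∧ ∃ᶠ n : ℕ in Filter.atTop, ∀ m : ℕ, m = ⌊α * n⌋₊ → ε ≤
        ((Finset.univ.filter fun Φ : Fin m → Fin k → Fin n × Bool => ∀ i, ∃ j,
          (f (Literature.Computability.Complexity.encodingCNF.encode (List.ofFn fun a =>
            List.ofFn fun b => (((Φ a b).1 : ℕ), (Φ a b).2)))).getD (Φ i j).1 false =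
              (Φ i j).2).card : ℝ) / Fintype.card (Fin m → Fin k → Fin n × Bool))
    (c : ℝ) (hc : 0 < c) :
    ∃ᶠ n : ℕ in Filter.atTop, ∀ m : ℕ, m = ⌊α * n⌋₊ →
      ∃ g : (Fin m → Fin k → Fin n × Bool) → (Fin n → Bool),
        Real.exp (-(c * n)) * Fintype.card (Fin (k + 1) → Fin m → Fin k → Fin n × Bool) ≤
        ((Finset.univ.filter fun Ψ : Fin (k + 1) → Fin m → Fin k → Fin n × Bool =>
          let P : Fin k → ℕ → Fin m → Fin k → Fin n × Bool :=
            fun r q a b => if (a : ℕ) * k + b < q then Ψ r.succ a b else Ψ r.castSucc a b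
          (∀ r : Fin k, ∀ q ≤ m * k, ((Finset.univ.filter fun i : Fin m =>
            ∀ j, g (P r q) (P r q i j).1 ≠ (P r q i j).2).card : ℝ) ≤ ν * m) ∧
          ∀ r : Fin k, ∀ q < m * k,
            (hammingDist (g (P r q)) (g (P r (q + 1))) : ℝ) ≤ η * n).card : ℝ) :=
  (sissW_conclusion_of_density_le k hk α η ν hα hαk hη hν c hc).frequently

/-- **The crux off the core region.** For every `k ≥ 3` and `α, η, ν > 0` with `4k·α ≤ 2^k`, or
`α ≥ 2^k log 2`, or `η ≥ 1`, or `ν > 2^{-k}`, or `ν > 2^{-k}(e^{kα2^{-k}} - 1)`, the implication of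
`SolvableImpliesStableSection` at `(k, α, η, ν)` holds (for `k ≥ 3`, `α < 2/k` implies `4kα < 8 ≤ 2^k`,
so the low-density blocks are subsumed). Supersedes `sissR_solvableImpliesStableSection_off_core`: the
sliver `{α ≤ 2^k/(4k)} ∩ {ν ≤ α^k/2^{k²}}` is gone; what remains of the crux is EXACTLY the core
`{2^k/(4k) < α < 2^k log 2} ∩ {η < 1} ∩ {ν ≤ 2^{-k} min(1, e^{kα2^{-k}} - 1)}` — summit-strength
inside the Bresler–Huang window (`transfer_false_without_polyTime`), f-free open elsewhere. -/
theorem sissW_solvableImpliesStableSection_off_core (k : ℕ) (hk : 3 ≤ k) (α η ν : ℝ) (hα : 0 < α)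
    (hη : 0 < η) (hν : 0 < ν)
    (hoff : α * (4 * k) ≤ (2 : ℝ) ^ k ∨ (2 : ℝ) ^ k * Real.log 2 ≤ α ∨ 1 ≤ η ∨ (1 / 2 : ℝ) ^ k < ν ∨
      (1 / 2 : ℝ) ^ k * (Real.exp (k * α * (1 / 2 : ℝ) ^ k) - 1) < ν)
    (hsolv : ∃ f : List Bool → List Bool, Literature.Computability.Complexity.IsPolyTime f ∧
      ∃ ε : ℝ, 0 < ε ∧ ∃ᶠ n : ℕ in Filter.atTop, ∀ m : ℕ, m = ⌊α * n⌋₊ → ε ≤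
        ((Finset.univ.filter fun Φ : Fin m → Fin k → Fin n × Bool => ∀ i, ∃ j,
          (f (Literature.Computability.Complexity.encodingCNF.encode (List.ofFn fun a =>
            List.ofFn fun b => (((Φ a b).1 : ℕ), (Φ a b).2)))).getD (Φ i j).1 false =
              (Φ i j).2).card : ℝ) / Fintype.card (Fin m → Fin k → Fin n × Bool))
    (c : ℝ) (hc : 0 < c) :
    ∃ᶠ n : ℕ in Filter.atTop, ∀ m : ℕ, m = ⌊α * n⌋₊ →
      ∃ g : (Fin m → Fin k → Fin n × Bool) → (Fin n → Bool),
        Real.exp (-(c * n)) * Fintype.card (Fin (k + 1) → Fin m → Fin k → Fin n × Bool) ≤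
        ((Finset.univ.filter fun Ψ : Fin (k + 1) → Fin m → Fin k → Fin n × Bool =>
          let P : Fin k → ℕ → Fin m → Fin k → Fin n × Bool :=
            fun r q a b => if (a : ℕ) * k + b < q then Ψ r.succ a b else Ψ r.castSucc a b
          (∀ r : Fin k, ∀ q ≤ m * k, ((Finset.univ.filter fun i : Fin m =>
            ∀ j, g (P r q) (P r q i j).1 ≠ (P r q i j).2).card : ℝ) ≤ ν * m) ∧
          ∀ r : Fin k, ∀ q < m * k,
            (hammingDist (g (P r q)) (g (P r (q + 1))) : ℝ) ≤ η * n).card : ℝ) := by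
  rcases hoff with hαk | hrest
  · exact sissW_solvableImpliesStableSection_of_density_le k hk α η ν hα hαk hη hν hsolv c hc
  · exact sissQ_solvableImpliesStableSection_off_core k hk α η ν hα hη hν (Or.inr hrest) hsolv c hc

end Assembly

end Summit.PneNP.PneNP.Theorems
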